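import Summits.Ventures.AbcSig.Rows.XTemplateC2a
import Summits.Ventures.AbcSig.Levels.N59
import Summits.Ventures.AbcSig.Levels.N59M6X
import Summits.Ventures.AbcSig.Rows.XTemplateE3

/-!
# Venture AbcSig — ROW `C2aL59A6eq`: `xⁿ + 2^a·59^m·yⁿ = z²`, class `a 6` (GENERATED by plean/leanrow.py)

E-VARIANT (p-lean g6 `gen6/e3patch.py`; ERRATA E3 form): same statement as `xrow_C2aL59A6eq` with ONE more named CITED hypothesis `(hE3 : M.E3Package)` (`Recipes/E3Package.lean`: referee record E3-LEVEL-LEMMA — for `ord₂ B = 6` and `y` even the level-lowered newform sits at the ODD level) and WITHOUT the printed-reading level 118: the sub-class `y` even is sieved at the level 59 like the rows of record do (R3 'Serre level → core (decisive); the 2·core sieve is informational'), so the `DataComplete 118` hypothesis and the uncertified cited survivors of level 118 (citation-backing audit plean/g5/THETAVERIFY-RECORD.md Part C, class INFORMATIONAL-LEVEL) are gone; templates `Rows/XTemplateE3.lean`.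
HONEST FRAMING. A row of a COMPUTATION cell (`pub-abcsig`); a CONDITIONAL theorem, no claim on ABC or any summit.
Hypotheses: `BS04Package` (CITED), `DataComplete` at levels [59, 118] (COMPUTED, two-engine certified
level files), `EisPackage` (CITED: [BS04 (3.1), L4.2, Cor 3.1] + [Sturm 1987]) and `Refines` (COMPUTED) for the orbits whose residual exponent is discharged IN THE KERNEL by a module-M6 certificate (`Levels/N…M6X.lean`), and the listed per-orbit exclusions `hX_…` (CITED; the
row's R5 cell names each) that remain. Everything else is kernel-checked (`Rows/XTemplateC2a.lean`, `Levels/N….lean`). Exponent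
range: prime `n ≥ 11`, `n ≠ 59`; `B = 2^a 59^m` with `a, m < n` (n-th-power free).
Row of record:  (sha256 ; SIGNED 2026-08-22T08:50:29Z by referee (ref-g4)); its R0: THEOREM (uses CITED arithmetic facts) for all primes n >= 11 with n coprime to 3776 — class: R-a COMPLETION candidate (closes a printed BS04 Thm 1.3 exception o. Exponents left open by the row of record are excluded here via ; kernel-sieve residuals the row of record closes by a cell module (M6 Eisenstein / M4 Kraus certificates) appear as CITED hypotheses .
-/

namespace Summit.Ventures.AbcSig

/-- Row `C2aL59A6eq` (see module docstring). -/
theorem xrow_C2aL59A6eqXE (M : NewformModel) (hP : M.BS04Package) (hE3 : M.E3Package) (hE : M.EisPackage)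
    (hD59 : M.DataComplete 59 level59Orbits)
    (hR_orbit_59_1 : M.Refines 59 orbit_59_1 m6X_59_1)
    (n : ℕ) (hn : n.Prime) (hmin : 11 ≤ n) (hnℓ : n ≠ 59) (m : ℕ) (hm : 1 ≤ m) (hmn : m < n)
    (x y z : ℤ) (hxy1 : x * y ≠ 1) (hxy2 : x * y ≠ -1) : ¬ IsPrimitiveSolution 1 (2 ^ 6 * 59 ^ m) 1 n x y z := by
  have hℓ : Nat.Prime 59 := by norm_num
  have h7 : 7 ≤ n := by omega
  have hS59 :=
    (level59_sieve n hn h7 (fun o => M.Excludes 59 o (famB (2 ^ 6 * 59 ^ m) n (fun _ _ => True)) ∨ M.ExcludesStd 59 o n) (fun hmem => by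
      rcases (by simpa using hmem : n = 7 ∨ n = 29) with rfl | rfl
      · omega
      · exact Or.inr (m6c_59_1_n29_excludes M hE hR_orbit_59_1)))
  exact xrowC2a_a6E3 59 hℓ (by norm_num) M hP hE3 n hn h7 hnℓ hD59 m hm hmn
    hS59 x y z hxy1 hxy2

end Summit.Ventures.AbcSig
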